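import Summits.NavierStokesRegularity.FluidComputer.GateBudget
import HarnessLib

/-!
# What no tuning can beat, part 6: the HALF-TURN (DOSE) LAW — the trigger pair `(b,c)` is itself a
# rotor, the amplifier can turn it by at most `π`, so the trigger's total dose is `μ∫c ≈ π`

Cell `pub-fluidc`, blueprint seat bp1 (gen 23); same namespace and conventions as parts 1–5; this
part imports part 1 only. HONEST FRAMING (verbatim): low prior, high value-of-information experiment
on Tao's machine paradigm; NOT a claim that NS blows up. Five-mode quadratic ODEs on `ℝ⁵`
(`fiveGateCircuit ε σ μ R K`: CLOCK pump `ε : a → b`, SEED pump `σ : a → c`, TRIGGER amplifier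
`μ : b ⇒ c`, rotor `R : c ∘ (a,d)`, DRAIN pump `K : d → ã`; Tao's retuned family
`delayCircuitWith K M ε` is the slice `σ = ε²e^{-M}, μ = ε⁻¹M, R = ε⁻²`) started EXACTLY at (5.6)
`delayInit`; nothing is proved about the Navier–Stokes equations.

## The law (found in the gen-23 toy, kit j089433: `σ_toy·M·∫₀^∞ u dt = 3.147…3.154` in EVERY run)

The amplifier gate `amplifierOn μ 1 2` is the vector field `(∂ₜb, ∂ₜc) = (-μc², μbc) = μc·(-c, b)`:
it is ORTHOGONAL to `(b,c)` — it conserves `b² + c²` (part 1, `bc_energy`) and ROTATES the trigger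
pair at angular speed exactly `μc`. Hence, wherever `c > 0`,

  `∂ₜ arctan(b/c) = -(μc + a²(σb - εc)/(b² + c²))`                    (`hasDerivAt_arctan_bc`):

the trigger level `c` IS (up to the two pump tilts) the angular velocity of its own phase. Since
`arctan ∈ (-π/2, π/2)`, the pair can turn by at most HALF A TURN over the whole life of the gate,
and the trigger's time-integral — its DOSE — obeys, on any window `[t₀,T]` on which `c > 0` and the
pair is ARMED (`b² + c² ≥ ϱ² > 0`), for every primitive `C` of `c` (`C' = c`; no integral appears):

  `(μ - ε/ϱ²)(C(T) - C(t₀)) ≤ arctan(b/c)(t₀) - arctan(b/c)(T) + σ(T-t₀)/ϱ < π + σ(T-t₀)/ϱ`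
                                                              (`dose_law`, `dose_le_half_turn`),
  `μ(C(T) - C(t₀)) ≥ arctan(b/c)(t₀) - arctan(b/c)(T) - σ(T-t₀)/ϱ`          (`dose_law_lower`).

For Tao's family (`ϱ = κε`): `(M - κ⁻²)(C(T) - C(t₀)) ≤ επ + ε²e^{-M}(T-t₀)/κ` (`taoFamily_dose`),
so the ROTOR's total ACTION on the carrier, `R∫c = ε⁻²∫c`, is at most
`(π/ε + e^{-M}(T-t₀)/κ)/(M - κ⁻²)` (`taoFamily_rotor_action`) and — by the lower law, once the
clock has gone from armed (`b ≫ c > 0`, `arctan ≈ π/2`) to reversed (`-b ≫ c`, `arctan ≈ -π/2`) —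
at least `≈ π/(εM)` as well: the carrier `(a,d)` is turned by the FIXED total angle
`Φ_tot ≈ π/(εM) = πR/μ`, whatever `K` is. This is the
deterministic origin of the toy's PHASE LAW (data README `pub-fluidc-bp1/data/g23-toy/`): complete
hand-over at polynomial tuning happens either ROBUSTLY (carrier emptied by the drain while the rotor
still turns) or at the isolated LUCKY scales where `Φ_tot ≡ π/2 (mod π)` up to the drain's phase
shift — measured completion peaks at `Φ_tot/π = n + 0.56 ± 0.06`, stalls deepest at `n + 0.05`.

HONEST LIMITS. Inequalities for every signs-admissible member; the hypotheses `c > 0` and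
`b² + c² ≥ ϱ²` on the window are ASSUMED (in Tao's certified regime `b ≥ ε/8` before firing gives
`ϱ = ε/8`); no statement about where the phase ends; `0` named facts; `0` sorry.
[cite: Tao2016AveragedNS, §5.5 Theorem 5.3, (5.5), (b-eq), (energy-con), (ob-2)].
-/

noncomputable section

namespace Summit.NavierStokesRegularity.FluidComputer.GateBudget

open Real Set Filter Topology
open Literature.Analysis.FluidPDE.Tao2016AveragedNS
open Literature.Analysis.FluidPDE.Tao2016AveragedNS.Thm53 (antitoneOn_sub_of_deriv_le
  monotoneOn_sub_of_le_deriv)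

variable {ε σ μ R K : ℝ} {X : ℝ → Fin 5 → ℝ}

/-! ## §14 The trigger pair is a rotor: the angle law -/

/-- **THE TRIGGER ANGLE LAW.** Where `c > 0`: `∂ₜ arctan(b/c) = -(μc + a²(σb - εc)/(b²+c²))` — the
amplifier rotates `(b,c)` at angular speed `μc`, the pumps tilt it by `a²(σb - εc)/(b²+c²)`.
[cite: Tao2016AveragedNS, §5.5 (5.5), (b-eq)] -/
theorem hasDerivAt_arctan_bc (hX : ∀ t, HasDerivAt X (fiveGateCircuit ε σ μ R K (X t)) t) {t : ℝ}
    (hc : 0 < X t 2) :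
    HasDerivAt (fun s => arctan (X s 1 / X s 2))
      (-(μ * X t 2 + X t 0 ^ 2 * (σ * X t 1 - ε * X t 2) / (X t 1 ^ 2 + X t 2 ^ 2))) t := by
  have hc0 : X t 2 ≠ 0 := hc.ne'
  have hr : X t 1 ^ 2 + X t 2 ^ 2 ≠ 0 := by positivity
  have hr' : X t 2 ^ 2 + X t 1 ^ 2 ≠ 0 := by positivity
  refine (((hasDerivAt_b hX t).div (hasDerivAt_c hX t) hc0).arctan).congr_deriv ?_
  simp only [Pi.div_apply]
  field_simp
  ring

/-- Pointwise DOSE INEQUALITIES. With `a² ≤ 1`, `c > 0`, `ϱ > 0`, `ϱ² ≤ b² + c²`, `ε, σ ≥ 0`: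
`-σ/ϱ ≤ a²(εc - σb)/(b²+c²) ≤ εc/ϱ² + σ/ϱ` (the pump tilts are small while the pair is armed).
[cite: Tao2016AveragedNS, §5.5 (est)] -/
theorem tilt_bounds {a b c ϱ : ℝ} (ha : a ^ 2 ≤ 1) (hc : 0 < c) (hϱ : 0 < ϱ)
    (hr : ϱ ^ 2 ≤ b ^ 2 + c ^ 2) (hε : 0 ≤ ε) (hσ : 0 ≤ σ) :
    -(σ / ϱ) ≤ a ^ 2 * (ε * c - σ * b) / (b ^ 2 + c ^ 2) ∧
      a ^ 2 * (ε * c - σ * b) / (b ^ 2 + c ^ 2) ≤ ε * c / ϱ ^ 2 + σ / ϱ := by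
  have hr0 : 0 < b ^ 2 + c ^ 2 := by positivity
  have ha0 : 0 ≤ a ^ 2 := sq_nonneg a
  -- the pair is armed: `|b|·ϱ ≤ b² + c²`, so the `σ`-tilt is at most `σ/ϱ` in size
  have hbϱ : |b| * ϱ ≤ b ^ 2 + c ^ 2 := by
    nlinarith [sq_nonneg (|b| - ϱ), sq_abs b, sq_nonneg c]
  have hkey : |σ * b * a ^ 2| ≤ σ * (b ^ 2 + c ^ 2) / ϱ := by
    rw [le_div_iff₀ hϱ, abs_mul, abs_mul, abs_of_nonneg hσ, abs_of_nonneg ha0]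
    have h1 : σ * |b| * a ^ 2 * ϱ ≤ σ * |b| * 1 * ϱ :=
      mul_le_mul_of_nonneg_right (mul_le_mul_of_nonneg_left ha (by positivity)) hϱ.le
    calc σ * |b| * a ^ 2 * ϱ ≤ σ * |b| * 1 * ϱ := h1
      _ = σ * (|b| * ϱ) := by ring
      _ ≤ σ * (b ^ 2 + c ^ 2) := mul_le_mul_of_nonneg_left hbϱ hσ
  have hhi : σ * b * a ^ 2 ≤ σ * (b ^ 2 + c ^ 2) / ϱ := (le_abs_self _).trans hkey
  have hlo : -(σ * b * a ^ 2) ≤ σ * (b ^ 2 + c ^ 2) / ϱ := (neg_le_abs _).trans hkey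
  have hεc : 0 ≤ a ^ 2 * (ε * c) := by positivity
  have hεc' : a ^ 2 * (ε * c) ≤ ε * c / ϱ ^ 2 * (b ^ 2 + c ^ 2) := by
    have h4 : ε * c ≤ ε * c / ϱ ^ 2 * (b ^ 2 + c ^ 2) := by
      rw [div_mul_eq_mul_div, le_div_iff₀ (by positivity)]
      exact mul_le_mul_of_nonneg_left hr (by positivity)
    nlinarith [mul_le_of_le_one_left (by positivity : 0 ≤ ε * c) ha]
  have e1 : σ * (b ^ 2 + c ^ 2) / ϱ = σ / ϱ * (b ^ 2 + c ^ 2) := by ring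
  constructor
  · rw [le_div_iff₀ hr0]
    linarith
  · rw [div_le_iff₀ hr0]
    linarith

/-! ## §15 The dose laws: the amplifier delivers at most half a turn -/

/-- **THE DOSE LAW (upper).** On a window `[t₀,T]` with `c > 0` and `b² + c² ≥ ϱ² > 0`, for every
primitive `C` of the trigger (`C' = c`):
`(μ - ε/ϱ²)(C(T) - C(t₀)) ≤ arctan(b(t₀)/c(t₀)) - arctan(b(T)/c(T)) + σ(T-t₀)/ϱ`.
[cite: Tao2016AveragedNS, §5.5 (5.5), (b-eq), (energy-con)] -/
theorem dose_law (hX : ∀ t, HasDerivAt X (fiveGateCircuit ε σ μ R K (X t)) t)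
    (h0 : X 0 = delayInit) (hε : 0 ≤ ε) (hσ : 0 ≤ σ) {t₀ T ϱ : ℝ} (ht : t₀ ≤ T) (hϱ : 0 < ϱ)
    (hc : ∀ t ∈ Icc t₀ T, 0 < X t 2) (hr : ∀ t ∈ Icc t₀ T, ϱ ^ 2 ≤ X t 1 ^ 2 + X t 2 ^ 2)
    {C : ℝ → ℝ} (hC : ∀ t ∈ Icc t₀ T, HasDerivAt C (X t 2) t) :
    (μ - ε / ϱ ^ 2) * (C T - C t₀)
      ≤ arctan (X t₀ 1 / X t₀ 2) - arctan (X T 1 / X T 2) + σ * (T - t₀) / ϱ := by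
  have hanti := antitoneOn_sub_of_deriv_le
    (f := fun r => (μ - ε / ϱ ^ 2) * C r + arctan (X r 1 / X r 2))
    (f' := fun r => (μ - ε / ϱ ^ 2) * X r 2
      + -(μ * X r 2 + X r 0 ^ 2 * (σ * X r 1 - ε * X r 2) / (X r 1 ^ 2 + X r 2 ^ 2)))
    (φ := fun _ => σ / ϱ) (Φ := fun r => σ / ϱ * r) (convex_Icc t₀ T)
    (fun r hr' => ((hC r hr').const_mul _).add (hasDerivAt_arctan_bc hX (hc r hr')))
    (fun r _ => ((hasDerivAt_id' r).const_mul (σ / ϱ)).congr_deriv (by simp))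
    (fun r hr' => by
      have h := (tilt_bounds (traj_sq_le_one hX h0 r 0) (hc r hr') hϱ (hr r hr') hε hσ).2
      have he : X r 0 ^ 2 * (σ * X r 1 - ε * X r 2) / (X r 1 ^ 2 + X r 2 ^ 2)
          = -(X r 0 ^ 2 * (ε * X r 2 - σ * X r 1) / (X r 1 ^ 2 + X r 2 ^ 2)) := by ring
      show (μ - ε / ϱ ^ 2) * X r 2
        + -(μ * X r 2 + X r 0 ^ 2 * (σ * X r 1 - ε * X r 2) / (X r 1 ^ 2 + X r 2 ^ 2)) ≤ σ / ϱ
      rw [he]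
      have : (μ - ε / ϱ ^ 2) * X r 2 = μ * X r 2 - ε * X r 2 / ϱ ^ 2 := by ring
      linarith)
  have h := hanti (left_mem_Icc.2 ht) (right_mem_Icc.2 ht) ht
  dsimp only at h
  have : σ / ϱ * T - σ / ϱ * t₀ = σ * (T - t₀) / ϱ := by ring
  linarith

/-- **HALF A TURN.** Same window: `(μ - ε/ϱ²)(C(T) - C(t₀)) < π + σ(T-t₀)/ϱ` — the trigger's dose
is at most half a turn of its own phase plus the pump tilts, WHATEVER the rotor and drain do.
[cite: Tao2016AveragedNS, §5.5 (5.5), (b-eq)] -/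
theorem dose_le_half_turn (hX : ∀ t, HasDerivAt X (fiveGateCircuit ε σ μ R K (X t)) t)
    (h0 : X 0 = delayInit) (hε : 0 ≤ ε) (hσ : 0 ≤ σ) {t₀ T ϱ : ℝ} (ht : t₀ ≤ T) (hϱ : 0 < ϱ)
    (hc : ∀ t ∈ Icc t₀ T, 0 < X t 2) (hr : ∀ t ∈ Icc t₀ T, ϱ ^ 2 ≤ X t 1 ^ 2 + X t 2 ^ 2)
    {C : ℝ → ℝ} (hC : ∀ t ∈ Icc t₀ T, HasDerivAt C (X t 2) t) :
    (μ - ε / ϱ ^ 2) * (C T - C t₀) < π + σ * (T - t₀) / ϱ := by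
  have h := dose_law hX h0 hε hσ ht hϱ hc hr hC
  have h1 := arctan_lt_pi_div_two (X t₀ 1 / X t₀ 2)
  have h2 := neg_pi_div_two_lt_arctan (X T 1 / X T 2)
  linarith

/-- **THE DOSE LAW (lower).** Same window: `μ(C(T) - C(t₀)) ≥ arctan(b(t₀)/c(t₀)) -
arctan(b(T)/c(T)) - σ(T-t₀)/ϱ` — a clock that went from armed (`arctan ≈ π/2`) to reversed
(`arctan ≈ -π/2`) was given (almost) the full half-turn dose.
[cite: Tao2016AveragedNS, §5.5 (5.5)] -/
theorem dose_law_lower (hX : ∀ t, HasDerivAt X (fiveGateCircuit ε σ μ R K (X t)) t)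
    (h0 : X 0 = delayInit) (hε : 0 ≤ ε) (hσ : 0 ≤ σ) {t₀ T ϱ : ℝ} (ht : t₀ ≤ T) (hϱ : 0 < ϱ)
    (hc : ∀ t ∈ Icc t₀ T, 0 < X t 2) (hr : ∀ t ∈ Icc t₀ T, ϱ ^ 2 ≤ X t 1 ^ 2 + X t 2 ^ 2)
    {C : ℝ → ℝ} (hC : ∀ t ∈ Icc t₀ T, HasDerivAt C (X t 2) t) :
    arctan (X t₀ 1 / X t₀ 2) - arctan (X T 1 / X T 2) - σ * (T - t₀) / ϱ
      ≤ μ * (C T - C t₀) := by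
  have hmono := monotoneOn_sub_of_le_deriv
    (f := fun r => μ * C r + arctan (X r 1 / X r 2))
    (f' := fun r => μ * X r 2
      + -(μ * X r 2 + X r 0 ^ 2 * (σ * X r 1 - ε * X r 2) / (X r 1 ^ 2 + X r 2 ^ 2)))
    (φ := fun _ => -(σ / ϱ)) (Φ := fun r => -(σ / ϱ) * r) (convex_Icc t₀ T)
    (fun r hr' => ((hC r hr').const_mul _).add (hasDerivAt_arctan_bc hX (hc r hr')))
    (fun r _ => ((hasDerivAt_id' r).const_mul (-(σ / ϱ))).congr_deriv (by simp))
    (fun r hr' => by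
      have h := (tilt_bounds (traj_sq_le_one hX h0 r 0) (hc r hr') hϱ (hr r hr') hε hσ).1
      have he : X r 0 ^ 2 * (σ * X r 1 - ε * X r 2) / (X r 1 ^ 2 + X r 2 ^ 2)
          = -(X r 0 ^ 2 * (ε * X r 2 - σ * X r 1) / (X r 1 ^ 2 + X r 2 ^ 2)) := by ring
      show -(σ / ϱ) ≤ μ * X r 2
        + -(μ * X r 2 + X r 0 ^ 2 * (σ * X r 1 - ε * X r 2) / (X r 1 ^ 2 + X r 2 ^ 2))
      rw [he]
      linarith)
  have h := hmono (left_mem_Icc.2 ht) (right_mem_Icc.2 ht) ht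
  dsimp only at h
  have : -(σ / ϱ) * T - -(σ / ϱ) * t₀ = -(σ * (T - t₀) / ϱ) := by ring
  linarith

/-! ## §16 Tao's family: the dose is `≈ πε/M`, the rotor's action on the carrier `≈ π/(εM)` -/

/-- **TAO-FAMILY DOSE LAW.** For `delayCircuitWith K M ε` (`0 < ε ≤ 1`), on a window `[t₀,T]` with
`c > 0` and `b² + c² ≥ (κε)²` (`κ > 0`), for every primitive `C` of `c`:
`(M - κ⁻²)(C(T) - C(t₀)) ≤ ε(arctan(b/c)(t₀) - arctan(b/c)(T)) + ε²e^{-M}(T-t₀)/κ ≤ επ + …`: the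
trigger's dose is at most `≈ πε/M`. [cite: Tao2016AveragedNS, §5.5 Theorem 5.3, (5.5)] -/
theorem taoFamily_dose {K M ε : ℝ} {X : ℝ → Fin 5 → ℝ}
    (hX : ∀ t, HasDerivAt X (delayCircuitWith K M ε (X t)) t) (h0 : X 0 = delayInit)
    (hε : 0 < ε) {t₀ T κ : ℝ} (ht : t₀ ≤ T) (hκ : 0 < κ)
    (hc : ∀ t ∈ Icc t₀ T, 0 < X t 2) (hr : ∀ t ∈ Icc t₀ T, (κ * ε) ^ 2 ≤ X t 1 ^ 2 + X t 2 ^ 2)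
    {C : ℝ → ℝ} (hC : ∀ t ∈ Icc t₀ T, HasDerivAt C (X t 2) t) :
    (M - (κ ^ 2)⁻¹) * (C T - C t₀)
      ≤ ε * (arctan (X t₀ 1 / X t₀ 2) - arctan (X T 1 / X T 2))
        + ε ^ 2 * exp (-M) * (T - t₀) / κ := by
  rw [delayCircuitWith_eq_fiveGate] at hX
  have h := dose_law hX h0 hε.le (by positivity) ht (by positivity : 0 < κ * ε) hc hr hC
  have hε0 : ε ≠ 0 := hε.ne'
  have hκ0 : κ ≠ 0 := hκ.ne'
  have h1 : ε⁻¹ * M - ε / (κ * ε) ^ 2 = (M - (κ ^ 2)⁻¹) / ε := by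
    field_simp
  have h2 : ε ^ 2 * exp (-M) * (T - t₀) / (κ * ε) = ε * exp (-M) * (T - t₀) / κ := by
    field_simp
  rw [h1, h2, div_mul_eq_mul_div, div_le_iff₀ hε] at h
  have h3 : ε ^ 2 * exp (-M) * (T - t₀) / κ = ε * exp (-M) * (T - t₀) / κ * ε := by ring
  rw [h3]
  linarith

/-- **TAO-FAMILY HALF-TURN.** Same window: `(M - κ⁻²)(C(T) - C(t₀)) < επ + ε²e^{-M}(T-t₀)/κ`.
[cite: Tao2016AveragedNS, §5.5 Theorem 5.3, (5.5)] -/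
theorem taoFamily_dose_le_half_turn {K M ε : ℝ} {X : ℝ → Fin 5 → ℝ}
    (hX : ∀ t, HasDerivAt X (delayCircuitWith K M ε (X t)) t) (h0 : X 0 = delayInit)
    (hε : 0 < ε) {t₀ T κ : ℝ} (ht : t₀ ≤ T) (hκ : 0 < κ)
    (hc : ∀ t ∈ Icc t₀ T, 0 < X t 2) (hr : ∀ t ∈ Icc t₀ T, (κ * ε) ^ 2 ≤ X t 1 ^ 2 + X t 2 ^ 2)
    {C : ℝ → ℝ} (hC : ∀ t ∈ Icc t₀ T, HasDerivAt C (X t 2) t) :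
    (M - (κ ^ 2)⁻¹) * (C T - C t₀) < ε * π + ε ^ 2 * exp (-M) * (T - t₀) / κ := by
  have h := taoFamily_dose hX h0 hε ht hκ hc hr hC
  have h1 := arctan_lt_pi_div_two (X t₀ 1 / X t₀ 2)
  have h2 := neg_pi_div_two_lt_arctan (X T 1 / X T 2)
  have h3 : ε * (arctan (X t₀ 1 / X t₀ 2) - arctan (X T 1 / X T 2)) < ε * π :=
    mul_lt_mul_of_pos_left (by linarith) hε
  linarith

/-- **THE ROTOR'S ACTION ON THE CARRIER** (`R∫c = ε⁻²(C(T) - C(t₀))`) for Tao's family: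
`(M - κ⁻²)·ε⁻²(C(T) - C(t₀)) < π/ε + e^{-M}(T-t₀)/κ` — the carrier `(a,d)` is turned by a total
angle `≲ π/(εM)`, independently of `K`.
[cite: Tao2016AveragedNS, §5.5 Theorem 5.3, (5.5), (ob-2)] -/
theorem taoFamily_rotor_action {K M ε : ℝ} {X : ℝ → Fin 5 → ℝ}
    (hX : ∀ t, HasDerivAt X (delayCircuitWith K M ε (X t)) t) (h0 : X 0 = delayInit)
    (hε : 0 < ε) {t₀ T κ : ℝ} (ht : t₀ ≤ T) (hκ : 0 < κ)
    (hc : ∀ t ∈ Icc t₀ T, 0 < X t 2) (hr : ∀ t ∈ Icc t₀ T, (κ * ε) ^ 2 ≤ X t 1 ^ 2 + X t 2 ^ 2)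
    {C : ℝ → ℝ} (hC : ∀ t ∈ Icc t₀ T, HasDerivAt C (X t 2) t) :
    (M - (κ ^ 2)⁻¹) * ((ε ^ 2)⁻¹ * (C T - C t₀)) < π / ε + exp (-M) * (T - t₀) / κ := by
  have h := taoFamily_dose_le_half_turn hX h0 hε ht hκ hc hr hC
  have hε0 : ε ≠ 0 := hε.ne'
  have hε2 : 0 < ε ^ 2 := by positivity
  have key : (M - (κ ^ 2)⁻¹) * ((ε ^ 2)⁻¹ * (C T - C t₀))
      = ((M - (κ ^ 2)⁻¹) * (C T - C t₀)) / ε ^ 2 := by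
    field_simp
  rw [key, div_lt_iff₀ hε2]
  have h2 : (π / ε + exp (-M) * (T - t₀) / κ) * ε ^ 2
      = ε * π + ε ^ 2 * exp (-M) * (T - t₀) / κ := by
    field_simp
  rw [h2]
  exact h

/-- **THE DOSE IS (ALMOST) THE FULL HALF-TURN once the clock is reversed** (Tao's family, lower
law):
`M(C(T) - C(t₀)) ≥ ε(arctan(b/c)(t₀) - arctan(b/c)(T)) - ε²e^{-M}(T-t₀)/κ`.
[cite: Tao2016AveragedNS, §5.5 Theorem 5.3, (5.5)] -/
theorem taoFamily_dose_lower {K M ε : ℝ} {X : ℝ → Fin 5 → ℝ}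
    (hX : ∀ t, HasDerivAt X (delayCircuitWith K M ε (X t)) t) (h0 : X 0 = delayInit)
    (hε : 0 < ε) {t₀ T κ : ℝ} (ht : t₀ ≤ T) (hκ : 0 < κ)
    (hc : ∀ t ∈ Icc t₀ T, 0 < X t 2) (hr : ∀ t ∈ Icc t₀ T, (κ * ε) ^ 2 ≤ X t 1 ^ 2 + X t 2 ^ 2)
    {C : ℝ → ℝ} (hC : ∀ t ∈ Icc t₀ T, HasDerivAt C (X t 2) t) :
    ε * (arctan (X t₀ 1 / X t₀ 2) - arctan (X T 1 / X T 2)) - ε ^ 2 * exp (-M) * (T - t₀) / κ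
      ≤ M * (C T - C t₀) := by
  rw [delayCircuitWith_eq_fiveGate] at hX
  have h := dose_law_lower hX h0 hε.le (by positivity) ht (by positivity : 0 < κ * ε) hc hr hC
  have hε0 : ε ≠ 0 := hε.ne'
  have hκ0 : κ ≠ 0 := hκ.ne'
  have h2 : ε ^ 2 * exp (-M) * (T - t₀) / (κ * ε) = ε * exp (-M) * (T - t₀) / κ := by
    field_simp
  have h4 : ε⁻¹ * M * (C T - C t₀) = M * (C T - C t₀) / ε := by
    field_simp
  rw [h2, h4, le_div_iff₀ hε] at h
  have h3 : ε ^ 2 * exp (-M) * (T - t₀) / κ = ε * exp (-M) * (T - t₀) / κ * ε := by ring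
  rw [h3]
  linarith

end Summit.NavierStokesRegularity.FluidComputer.GateBudget

end
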